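import Mathlib
import Literature.MathematicalPhysics.QuantumFieldTheory.BalabanImbrieJaffe1984to88.BIJ85LandauMinimizer442
import Literature.MathematicalPhysics.QuantumFieldTheory.Balaban1983to89.B5Positivity172Lattice
import Literature.MathematicalPhysics.QuantumFieldTheory.Balaban1983to89.B5AveragingOnto

/-!
# `BalabanImbrieJaffe1984to88.BIJ85LandauMinimizer442V1` — T. Bałaban, J. Imbrie, A. Jaffe, *Renormalization of the Higgs
model: minimizers, propagators and the stability of mean field theory*, Commun. Math. Phys. **97** (1985) 299–329
[BalabanImbrieJaffe1985]: Sect. 4.4 pp. 311–313, the Landau-gauge minimizer `H_kB` (4.4.2) ON THE V1 LATTICE CALCULUS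
`Balaban1983to89.LatticeFieldCalculus` (file 3 of the row; file 1 = `BIJ85LandauForm441`, the operators and the quadratic form;
file 2 = `BIJ85LandauMinimizer442`, the Gaussian integrals (4.4.1)–(4.4.3) over an abstract carrier `LandauOps`)

statement-level skeleton of published theorems with citation tags; proofs where landed; nothing here is a claim about the Yang–Mills mass gap

PDF held: `paper:balaban1985-cmp97-bij-higgs-minimizers` (journal page = PDF page + 298); [6I] = [Balaban1984PropagatorsI] =
`paper:balaban1984-cmp95-propagators-rt-i` (journal page = PDF page + 16; text layer, pp. 25, 26, 29, 30 read).

CITATION HEADER (lean-in-tree rule).  Phase-2 proof seat p11 of the mega-formalization `lit-balaban` (HOME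
`run/shared/lean/pub/lit-balaban/`), SPARE row **C1.Eq4.4.1-4.4.3** of `PHASE2-TARGETS.md` §G.6 (footer list), instance file.
THE PRINTED TEXT, verbatim.  p. 312: *"where Q′ denotes the ordinary average over k-blocks. Such a Faddeev-Popov type choice leads
to the formula for the Landau gauge minimizer H_kB = Z_k(B)⁻¹∫𝒟A δ(Q_kA − B)𝒢(∂*A) A exp(−½‖∂A‖²), (4.4.2)"*; p. 313: *"Recall
that H_kB is the configuration which minimizes the action ½‖∂A‖², subject to a gauge condition as well as the restriction Q_kA = B
on field averages."*  [6I] p. 25: *"It is an orthogonal projection on the linear subspace ΔN(Q′_k) of L²(T_η), N(Q′_k) = {λ :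
Q′_kλ = 0}. … the operator Δ is positive definite on N(Q′_k), thus invertible, as it follows from [2]"*; p. 26: *"under the
conditions Q_kA = B, R∂*A = 0"*; p. 29: *"we can verify all the properties of H_kB: Q_kH_kB = B, R∂*H_kB = 0, H_kB is a minimum of
½⟨∂A, ∂A⟩ on the hyperplane {A : Q_kA = B, R∂*A = 0}"*; p. 30: *"QA = ∂₁ω + A₀ = 0, hence ∂₁*∂₁ω = 0, and this implies ω = 0. The
above equation implies A₀ = 0, so A = 0 and the positivity of Δ_a follows."*

WHAT IS TYPED HERE.  The instance `opsV1 P k c s` of the carrier `BIJ85LandauForm441.LandauOps` given by the V1 lattice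
calculus on the torus `T^{(0)}` of `Balaban1983to89.Setup`: ∂ = `curl c`, ∂* = `diverg c`, Δ = `laplace c` (lattice factor
`c = η⁻¹`), each followed by the norm weight `s` (`s² = η^d`, so that `‖∂A‖² = s²Σ_p|curl A(p)|²` is the printed η-lattice norm),
Q_k = `bondAvgIter k`, Q′ = `siteAvgIter k`, on the Euclidean spaces of bond / site / plaquette functions; the gauge
gradient `gradV1 P c` = `grad c`.  PROVED, in the standing range `k ≤ m + K` and for `c ≠ 0`, `s ≠ 0`: the abelian gauge structure
`∂∂λ = 0`, `∂*∂λ = Δλ`, `Q_k∂λ = 0 (λ ∈ N(Q′_k))` (`gaugeStructure_V1`, from `LatticeFieldCalculus.curl_grad/diverg_grad` and (1.20)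
`B5Eq120IterProof.bondAvgIter_grad`); BOTH displayed hypotheses of `BIJ85LandauMinimizer442.Hk_isLandauMinimizer` — «Δ invertible on
N(Q′_k)» [6I] p. 25 (`lapInjective_V1`) and the no-zero-modes input `Q_kv = 0 ∧ ∂v = 0 ∧ R∂*v = 0 ⇒ v = 0` of [6I] p. 30
(`noZeroModes_V1`) — from the torus statements of `Balaban1983to89.B5Positivity172Lattice` — and the non-emptiness of every fibre
`{Q_kA = B}` (`fibre_nonempty_V1`, from `Balaban1983to89.B5AveragingOnto`); hence, HYPOTHESIS-FREE up to the carrier clauses and for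
EVERY `B`, the p. 313 sentence for the V1 operators (`Hk_isLandauMinimizer_V1`: `Q_kH_kB = B`, `R∂*H_kB = 0`, `½‖∂H_kB‖² ≤ ½‖∂A‖²` on
`{Q_kA = B, R∂*A = 0}`), existence/uniqueness of the constrained minimizer with `Z_k(B) > 0` (`Hk_spec_V1`), and the identification
of (4.4.2) with the [6I] (1.47) minimizer (`eq_Hk_of_isMinOn_curl_V1`).  Carrier clauses (F6): `k ≤ m + K` (standing range of
`Setup`), `c ≠ 0`, `s ≠ 0`.  Axioms: the standard three.  Unit `lit-balaban-p11`
(literature-prover-lit-balaban-p11-0).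
-/

namespace Literature.MathematicalPhysics.QuantumFieldTheory.BalabanImbrieJaffe1984to88.BIJ85LandauMinimizer442V1

open Literature.MathematicalPhysics.QuantumFieldTheory.Balaban1983to89
open Literature.MathematicalPhysics.QuantumFieldTheory.Balaban1983to89.LatticeFieldCalculus
open Literature.MathematicalPhysics.QuantumFieldTheory.BalabanImbrieJaffe1984to88.BIJ85LandauForm441
open Literature.MathematicalPhysics.QuantumFieldTheory.BalabanImbrieJaffe1984to88.BIJ85LandauMinimizer442

noncomputable section

variable {P : Params} {j : ℕ}

/-! ## The V1 operators as ℝ-linear maps -/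

/-- `∂` (curl) as a linear map. [folklore] -/
private def curlLin (c : ℝ) : VecField P j ℝ →ₗ[ℝ] (Plaq P j → ℝ) where
  toFun A p := curl c A p
  map_add' A B := by funext p; simp only [curl, Pi.add_apply, smul_eq_mul]; ring
  map_smul' t A := by funext p; simp only [curl, Pi.smul_apply, smul_eq_mul, RingHom.id_apply]; ring

/-- `∂*` (divergence) as a linear map. [folklore] -/
private def divergLin (c : ℝ) : VecField P j ℝ →ₗ[ℝ] SiteField P j ℝ where
  toFun A := diverg c A
  map_add' A B := by
    funext x; simp only [diverg, Pi.add_apply, smul_eq_mul, ← Finset.sum_add_distrib]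
    exact Finset.sum_congr rfl fun μ _ => by ring
  map_smul' t A := by
    funext x; simp only [diverg, Pi.smul_apply, smul_eq_mul, RingHom.id_apply, Finset.mul_sum]
    exact Finset.sum_congr rfl fun μ _ => by ring

/-- `Δ` as a linear map. [folklore] -/
private def laplaceLin (c : ℝ) : SiteField P j ℝ →ₗ[ℝ] SiteField P j ℝ where
  toFun f := laplace c f
  map_add' f g := by
    funext x; simp only [laplace, Pi.add_apply, smul_eq_mul, ← Finset.sum_add_distrib]
    exact Finset.sum_congr rfl fun μ _ => by ring
  map_smul' t f := by
    funext x; simp only [laplace, Pi.smul_apply, smul_eq_mul, RingHom.id_apply, Finset.mul_sum]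
    exact Finset.sum_congr rfl fun μ _ => by ring

/-- `∂` (gradient) as a linear map. [folklore] -/
private def gradLin (c : ℝ) : SiteField P j ℝ →ₗ[ℝ] VecField P j ℝ where
  toFun lam := grad c lam
  map_add' f g := by funext b; simp only [grad, Pi.add_apply, smul_eq_mul]; ring
  map_smul' t f := by funext b; simp only [grad, Pi.smul_apply, smul_eq_mul, RingHom.id_apply]; ring

/-- `Q′` (one level) is additive. [folklore] -/
private theorem siteAvg_add (f g : SiteField P j ℝ) : siteAvg (f + g) = siteAvg f + siteAvg g := by
  funext y; simp only [siteAvg, Pi.add_apply, smul_eq_mul, Finset.sum_add_distrib]; ring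

/-- `Q′` (one level) is homogeneous. [folklore] -/
private theorem siteAvg_smul (t : ℝ) (f : SiteField P j ℝ) : siteAvg (t • f) = t • siteAvg f := by
  funext y; simp only [siteAvg, Pi.smul_apply, smul_eq_mul, Finset.mul_sum]
  exact Finset.sum_congr rfl fun r _ => by ring

/-- segment sums are additive. [folklore] -/
private theorem segSum_add (A B : VecField P j ℝ) (x : Site P j) (μ : Fin P.d) (n : ℕ) :
    segSum (A + B) x μ n = segSum A x μ n + segSum B x μ n := by
  simp only [segSum, Pi.add_apply, Finset.sum_add_distrib]

/-- segment sums are homogeneous. [folklore] -/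
private theorem segSum_smul (t : ℝ) (A : VecField P j ℝ) (x : Site P j) (μ : Fin P.d) (n : ℕ) :
    segSum (t • A) x μ n = t * segSum A x μ n := by
  simp only [segSum, Pi.smul_apply, smul_eq_mul, Finset.mul_sum]

/-- `Q` (one level) is additive. [folklore] -/
private theorem bondAvg_add (A B : VecField P j ℝ) : bondAvg (A + B) = bondAvg A + bondAvg B := by
  funext c; simp only [bondAvg, Pi.add_apply, smul_eq_mul, segSum_add, Finset.sum_add_distrib]; ring

/-- `Q` (one level) is homogeneous. [folklore] -/
private theorem bondAvg_smul (t : ℝ) (A : VecField P j ℝ) : bondAvg (t • A) = t • bondAvg A := by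
  funext c; simp only [bondAvg, Pi.smul_apply, smul_eq_mul, segSum_smul, Finset.mul_sum]
  exact Finset.sum_congr rfl fun r _ => by ring

/-- `Q′_k` as a linear map. [folklore] -/
private def siteAvgIterLin : (k : ℕ) → SiteField P 0 ℝ →ₗ[ℝ] SiteField P k ℝ
  | 0 => LinearMap.id
  | k + 1 =>
    { toFun := fun f => siteAvg (siteAvgIterLin k f)
      map_add' := fun f g => by rw [map_add, siteAvg_add]
      map_smul' := fun t f => by rw [map_smul, siteAvg_smul]; rfl }

/-- `Q_k` as a linear map. [folklore] -/
private def bondAvgIterLin : (k : ℕ) → VecField P 0 ℝ →ₗ[ℝ] VecField P k ℝ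
  | 0 => LinearMap.id
  | k + 1 =>
    { toFun := fun A => bondAvg (bondAvgIterLin k A)
      map_add' := fun A B => by rw [map_add, bondAvg_add]
      map_smul' := fun t A => by rw [map_smul, bondAvg_smul]; rfl }

/-- the bundled `Q′_k` is `siteAvgIter k`. [folklore] -/
private theorem siteAvgIterLin_apply : ∀ (k : ℕ) (f : SiteField P 0 ℝ), siteAvgIterLin k f = siteAvgIter k f
  | 0, _ => rfl
  | k + 1, f => by
    show siteAvg (siteAvgIterLin k f) = siteAvg (siteAvgIter k f)
    rw [siteAvgIterLin_apply k f]

/-- the bundled `Q_k` is `bondAvgIter k`. [folklore] -/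
private theorem bondAvgIterLin_apply : ∀ (k : ℕ) (A : VecField P 0 ℝ), bondAvgIterLin k A = bondAvgIter k A
  | 0, _ => rfl
  | k + 1, A => by
    show bondAvg (bondAvgIterLin k A) = bondAvg (bondAvgIter k A)
    rw [bondAvgIterLin_apply k A]

/-! ## The V1 instance of `LandauOps` -/

/-- the Euclidean structure `‖f‖² = Σ_i f(i)²` on functions on a finite index type, as a linear identification. [folklore] -/
private abbrev eucl (ι : Type*) : EuclideanSpace ℝ ι ≃ₗ[ℝ] (ι → ℝ) := WithLp.linearEquiv 2 ℝ (ι → ℝ)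

variable (P)

/-- **the V1 instance of the Sect. 4.4 operators** at step `k`, lattice factor `c` (= η⁻¹) and norm weight `s` (`s² = η^d`):
∂ = `s·curl c`, ∂* = `s·diverg c`, Δ = `s·laplace c` (so that `‖∂A‖²`, `‖∂*A − Δλ‖²` are the printed η^d-weighted sums),
Q_k = `bondAvgIter k`, Q′ = `siteAvgIter k` (*"the ordinary average over k-blocks"*) on the torus `T^{(0)}`.
[cite: BalabanImbrieJaffe1985, (4.4.1)–(4.4.3) p.311–312] -/
def opsV1 (k : ℕ) (c s : ℝ) : LandauOps (EuclideanSpace ℝ (PBond P 0)) (EuclideanSpace ℝ (Site P 0))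
    (EuclideanSpace ℝ (Plaq P 0)) (VecField P k ℝ) (SiteField P k ℝ) where
  curl := s • ((eucl (Plaq P 0)).symm.toLinearMap ∘ₗ curlLin c ∘ₗ (eucl (PBond P 0)).toLinearMap)
  dstar := s • ((eucl (Site P 0)).symm.toLinearMap ∘ₗ divergLin c ∘ₗ (eucl (PBond P 0)).toLinearMap)
  lap := s • ((eucl (Site P 0)).symm.toLinearMap ∘ₗ laplaceLin c ∘ₗ (eucl (Site P 0)).toLinearMap)
  Qk := bondAvgIterLin k ∘ₗ (eucl (PBond P 0)).toLinearMap
  Qp := siteAvgIterLin k ∘ₗ (eucl (Site P 0)).toLinearMap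

/-- the gauge gradient `∂λ` on the V1 carriers (gauge transformations `A ↦ A − ∂λ`, [6I] (1.20) *"QA^λ = QA − ∂Q′λ"*).
[cite: Balaban1984PropagatorsI, (1.20) p.20] -/
def gradV1 (c : ℝ) : EuclideanSpace ℝ (Site P 0) →ₗ[ℝ] EuclideanSpace ℝ (PBond P 0) :=
  (eucl (PBond P 0)).symm.toLinearMap ∘ₗ gradLin c ∘ₗ (eucl (Site P 0)).toLinearMap

variable {P}

/-- unfolding `∂` of the instance. [cite: BalabanImbrieJaffe1985, (4.4.1)–(4.4.3) p.311–312] -/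
@[simp] theorem opsV1_curl (k : ℕ) (c s : ℝ) (A : EuclideanSpace ℝ (PBond P 0)) :
    (opsV1 P k c s).curl A = s • WithLp.toLp 2 (curl c (WithLp.ofLp A)) := rfl

/-- unfolding `∂*` of the instance. [cite: BalabanImbrieJaffe1985, (4.4.1)–(4.4.3) p.311–312] -/
@[simp] theorem opsV1_dstar (k : ℕ) (c s : ℝ) (A : EuclideanSpace ℝ (PBond P 0)) :
    (opsV1 P k c s).dstar A = s • WithLp.toLp 2 (diverg c (WithLp.ofLp A)) := rfl

/-- unfolding `Δ` of the instance. [cite: BalabanImbrieJaffe1985, (4.4.1)–(4.4.3) p.311–312] -/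
@[simp] theorem opsV1_lap (k : ℕ) (c s : ℝ) (l : EuclideanSpace ℝ (Site P 0)) :
    (opsV1 P k c s).lap l = s • WithLp.toLp 2 (laplace c (WithLp.ofLp l)) := rfl

/-- unfolding `Q_k` of the instance. [cite: BalabanImbrieJaffe1985, (4.4.1)–(4.4.3) p.311–312] -/
@[simp] theorem opsV1_Qk (k : ℕ) (c s : ℝ) (A : EuclideanSpace ℝ (PBond P 0)) :
    (opsV1 P k c s).Qk A = bondAvgIter k (WithLp.ofLp A) := bondAvgIterLin_apply k _

/-- unfolding `Q′` of the instance. [cite: BalabanImbrieJaffe1985, (4.4.1)–(4.4.3) p.311–312] -/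
@[simp] theorem opsV1_Qp (k : ℕ) (c s : ℝ) (l : EuclideanSpace ℝ (Site P 0)) :
    (opsV1 P k c s).Qp l = siteAvgIter k (WithLp.ofLp l) := siteAvgIterLin_apply k _

/-- unfolding the gauge gradient. [cite: Balaban1984PropagatorsI, (1.20) p.20] -/
@[simp] theorem gradV1_apply (c : ℝ) (l : EuclideanSpace ℝ (Site P 0)) :
    gradV1 P c l = WithLp.toLp 2 (grad c (WithLp.ofLp l)) := rfl

/-- `grad` of the zero function vanishes. [folklore] -/
private theorem grad_zero' (c : ℝ) : grad c (0 : SiteField P j ℝ) = 0 := by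
  funext b; simp [grad]

/-- **the abelian gauge structure holds on V1** (standing range `k ≤ m + K`): `∂∂λ = 0`, `∂*∂λ = Δλ`, and `Q_k∂λ = ∂_{(k)}Q′_kλ = 0`
for `λ ∈ N(Q′_k)` ((1.20)). [cite: Balaban1984PropagatorsI, (1.20) p.20] -/
theorem gaugeStructure_V1 {k : ℕ} (hk : k ≤ P.m + P.K) (c s : ℝ) :
    (opsV1 P k c s).GaugeStructure (gradV1 P c) where
  curl_grad l := by
    rw [gradV1_apply, opsV1_curl, WithLp.ofLp_toLp]
    have : curl c (grad c (WithLp.ofLp l)) = 0 := by funext p; exact curl_grad c c _ p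
    rw [this]
    simp
  dstar_grad l := by
    rw [gradV1_apply, opsV1_dstar, opsV1_lap, WithLp.ofLp_toLp, diverg_grad]
  Qk_grad l hl := by
    rw [opsV1_Qp] at hl
    rw [gradV1_apply, opsV1_Qk, WithLp.ofLp_toLp, B5Eq120IterProof.bondAvgIter_grad k hk, hl, grad_zero']

/-! ## The two non-degeneracy inputs HOLD on V1 ([6I] p. 25, p. 30) -/

/-- **hypothesis `hL` of `BIJ85LandauMinimizer442.Hk_isLandauMinimizer` HOLDS on V1** ([6I] p. 25, verbatim: *"the operator Δ is
positive definite on N(Q′_k), thus invertible"*; its qualitative content `Q′_kλ = 0 ∧ Δλ = 0 ⇒ λ = 0` is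
`B5Positivity172Lattice.eq_zero_of_laplace_eq_zero`), for `opsV1 P k c s` with `c ≠ 0`, `s ≠ 0`. [cite: Balaban1984PropagatorsI, p.25 (text)] -/
theorem lapInjective_V1 (k : ℕ) {c s : ℝ} (hc : c ≠ 0) (hs : s ≠ 0) (l : EuclideanSpace ℝ (Site P 0))
    (hQ : (opsV1 P k c s).Qp l = 0) (hΔ : (opsV1 P k c s).lap l = 0) : l = 0 := by
  rw [opsV1_Qp] at hQ
  rw [opsV1_lap, smul_eq_zero] at hΔ
  have h2 : laplace c (WithLp.ofLp l) = 0 := by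
    rcases hΔ with h | h
    · exact absurd h hs
    · simpa using congrArg WithLp.ofLp h
  have h3 : WithLp.ofLp l = 0 := B5Positivity172Lattice.eq_zero_of_laplace_eq_zero hc k hQ h2
  simpa using congrArg (WithLp.toLp 2) h3

/-- **hypothesis `hZ` (no zero modes) of `BIJ85LandauMinimizer442.Hk_isLandauMinimizer` HOLDS on V1** — [6I] p. 30 after (1.72),
verbatim: *"QA = ∂₁ω + A₀ = 0, hence ∂₁*∂₁ω = 0, and this implies ω = 0. The above equation implies A₀ = 0, so A = 0 and the
positivity of Δ_a follows"* (there from `ΔA − ∂P∂*A = 0`, i.e. `∂A = 0 ∧ R∂*A = 0`, and `QA = 0`): in the standing range `k ≤ m + K`,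
for `c ≠ 0`, `s ≠ 0`, a field `v` on `T^{(0)}` with `Q_kv = 0`, `∂v = 0` and `R∂*v = 0` vanishes.  Route: `v = ∂φ` with `Q′_kφ = 0`
(`B5Positivity172Lattice.exists_grad_of_curl_eq_zero_of_bondAvgIter_eq_zero`), so `∂*v = Δφ ∈ ΔN(Q′_k) = R` and `R∂*v = Δφ = 0`
(`LandauOps.projR_lap_of_mem`), whence `φ = 0` (`lapInjective_V1`). [cite: Balaban1984PropagatorsI, (1.72) p.30] -/
theorem noZeroModes_V1 {k : ℕ} (hk : k ≤ P.m + P.K) {c s : ℝ} (hc : c ≠ 0) (hs : s ≠ 0)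
    (v : EuclideanSpace ℝ (PBond P 0)) (hQ : (opsV1 P k c s).Qk v = 0) (hcurl : (opsV1 P k c s).curl v = 0)
    (hR : (opsV1 P k c s).projR ((opsV1 P k c s).dstar v) = 0) : v = 0 := by
  rw [opsV1_Qk] at hQ
  rw [opsV1_curl, smul_eq_zero] at hcurl
  have hcurl' : curl c (WithLp.ofLp v) = 0 := by
    rcases hcurl with h | h
    · exact absurd h hs
    · simpa using congrArg WithLp.ofLp h
  obtain ⟨φ, hφQ, hφA⟩ :=
    B5Positivity172Lattice.exists_grad_of_curl_eq_zero_of_bondAvgIter_eq_zero hk hc hcurl' hQ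
  have hv : v = gradV1 P c (WithLp.toLp 2 φ) := by
    rw [gradV1_apply, WithLp.ofLp_toLp, ← hφA, WithLp.toLp_ofLp]
  have hl : (opsV1 P k c s).Qp (WithLp.toLp 2 φ) = 0 := by rw [opsV1_Qp, WithLp.ofLp_toLp, hφQ]
  rw [hv, (gaugeStructure_V1 hk c s).dstar_grad, (opsV1 P k c s).projR_lap_of_mem hl] at hR
  rw [hv, lapInjective_V1 k hc hs _ hl hR, map_zero]

/-- every fibre `{Q_kA = B}` of the V1 instance is non-empty (`Q_k` is onto, `B5AveragingOnto.bondAvgIter_surjective`).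
[cite: BalabanImbrieJaffe1985, (4.4.2) p.312] -/
theorem fibre_nonempty_V1 {k : ℕ} (hk : k ≤ P.m + P.K) (c s : ℝ) (B : VecField P k ℝ) :
    ∃ A : EuclideanSpace ℝ (PBond P 0), (opsV1 P k c s).Qk A = B := by
  obtain ⟨A, hA⟩ := B5AveragingOnto.bondAvgIter_surjective hk B
  exact ⟨WithLp.toLp 2 A, by rw [opsV1_Qk, WithLp.ofLp_toLp, hA]⟩

/-! ## The p. 313 sentence and the [6I] identification, on V1 -/

/-- **p. 313 on the V1 calculus, AS PRINTED, hypothesis-free in the standing range** (verbatim: *"Recall that H_kB is the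
configuration which minimizes the action ½‖∂A‖², subject to a gauge condition as well as the restriction Q_kA = B on field
averages"*): for `k ≤ m + K`, `c ≠ 0`, `s ≠ 0` and EVERY `B` on `T₁^{(k)}`, the field `H_kB` of (4.4.2) built from the V1 operators
satisfies `Q_kH_kB = B`, the Landau gauge condition `R∂*H_kB = 0` of [6I] p. 26, and `½‖∂H_kB‖² ≤ ½‖∂A‖²` for every `A` with
`Q_kA = B`, `R∂*A = 0` — the gauge structure, «Δ invertible on N(Q′_k)», the no-zero-modes input and the non-emptiness of the
fibre being THEOREMS here (`gaugeStructure_V1`, `lapInjective_V1`, `noZeroModes_V1`, `fibre_nonempty_V1`).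
[cite: BalabanImbrieJaffe1985, p.313 (text)] -/
theorem Hk_isLandauMinimizer_V1 {k : ℕ} (hk : k ≤ P.m + P.K) {c s : ℝ} (hc : c ≠ 0) (hs : s ≠ 0) (B : VecField P k ℝ) :
    (opsV1 P k c s).Qk (Hk (opsV1 P k c s) B) = B ∧
      (opsV1 P k c s).projR ((opsV1 P k c s).dstar (Hk (opsV1 P k c s) B)) = 0 ∧
      ∀ A : EuclideanSpace ℝ (PBond P 0), (opsV1 P k c s).Qk A = B →
        (opsV1 P k c s).projR ((opsV1 P k c s).dstar A) = 0 →
          (1 / 2 : ℝ) * ‖(opsV1 P k c s).curl (Hk (opsV1 P k c s) B)‖ ^ 2 ≤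
            (1 / 2 : ℝ) * ‖(opsV1 P k c s).curl A‖ ^ 2 :=
  Hk_isLandauMinimizer (opsV1 P k c s) (noZeroModes_V1 hk hc hs) (fun l => lapInjective_V1 k hc hs l)
    (gaugeStructure_V1 hk c s) (fibre_nonempty_V1 hk c s B)

/-- **(4.4.2) on V1: existence, minimality, positivity of (4.4.3) and uniqueness** — `Q_kH_kB = B`, `H_kB` minimizes
`E = ½‖∂A‖² + ½‖R∂*A‖²` on the fibre `{Q_kA = B}`, `Z_k(B) > 0`, and every minimizer on the fibre IS `H_kB` (for `k ≤ m + K`,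
`c ≠ 0`, `s ≠ 0`, every `B`). [cite: BalabanImbrieJaffe1985, (4.4.2) p.312] -/
theorem Hk_spec_V1 {k : ℕ} (hk : k ≤ P.m + P.K) {c s : ℝ} (hc : c ≠ 0) (hs : s ≠ 0) (B : VecField P k ℝ) :
    (opsV1 P k c s).Qk (Hk (opsV1 P k c s) B) = B ∧
      IsMinOn (opsV1 P k c s).energy ((opsV1 P k c s).Fibre B) (Hk (opsV1 P k c s) B) ∧ 0 < Zk (opsV1 P k c s) B ∧
      ∀ A₀, (opsV1 P k c s).Qk A₀ = B → IsMinOn (opsV1 P k c s).energy ((opsV1 P k c s).Fibre B) A₀ →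
        A₀ = Hk (opsV1 P k c s) B :=
  Hk_spec (opsV1 P k c s) (noZeroModes_V1 hk hc hs) (fun l => lapInjective_V1 k hc hs l) (fibre_nonempty_V1 hk c s B)

/-- **(4.4.2) on V1 IS the [6I] (1.47) minimizer** ([6I] p. 26, verbatim: *"a configuration A on T_η minimizing the form
½⟨∂A, ∂A⟩ under the conditions Q_kA = B, R∂*A = 0"*; p. 29: *"H_kB is a minimum of ½⟨∂A, ∂A⟩ on the hyperplane {A : Q_kA = B,
R∂*A = 0}"*): any minimizer of `½‖∂A‖²` over `{Q_kA = B, R∂*A = 0}` for the V1 operators equals `H_kB` (`k ≤ m + K`, `c ≠ 0`,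
`s ≠ 0`). [cite: Balaban1984PropagatorsI, (1.47) p.26] -/
theorem eq_Hk_of_isMinOn_curl_V1 {k : ℕ} (hk : k ≤ P.m + P.K) {c s : ℝ} (hc : c ≠ 0) (hs : s ≠ 0)
    {B : VecField P k ℝ} {A₁ : EuclideanSpace ℝ (PBond P 0)} (hA₁ : (opsV1 P k c s).Qk A₁ = B)
    (hA₁R : (opsV1 P k c s).projR ((opsV1 P k c s).dstar A₁) = 0)
    (hmin : IsMinOn (fun A => (1 / 2 : ℝ) * ‖(opsV1 P k c s).curl A‖ ^ 2)
      {A | (opsV1 P k c s).Qk A = B ∧ (opsV1 P k c s).projR ((opsV1 P k c s).dstar A) = 0} A₁) :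
    A₁ = Hk (opsV1 P k c s) B :=
  eq_Hk_of_isMinOn_curl (opsV1 P k c s) (noZeroModes_V1 hk hc hs) (fun l => lapInjective_V1 k hc hs l)
    (gaugeStructure_V1 hk c s) hA₁ hA₁R hmin

end

end Literature.MathematicalPhysics.QuantumFieldTheory.BalabanImbrieJaffe1984to88.BIJ85LandauMinimizer442V1
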